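import Summits.MatrixMultiplication.MatrixMultiplication.Theorems.SoloBlindAbelianRealization
import HarnessLib

/-!
# Slice spans and the sumset refinement of `R ≤ |H|` for abelian-group tensors

Two general facts and their consequence for abelian realizations of `T_{cw,2}^{⊠N}`.

1. **Slice-span lemma** (`tensorRank_sum_triad_le_finrank_span`).  If
   `t = ∑_s w_s ⊗ u_s ⊗ v_s` then `R(t) ≤ dim span{w_s ⊗ u_s}`: pick a basis of the span of the
   rank-one slices `w_s ⊗ u_s` among the slices themselves and re-express the others — the third legs
   absorb the coefficients.  (This is the bookkeeping behind "free" one-slice speedups of tensor powers,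
   arXiv:2605.21738 §5: linear dependencies among the `a_i ⊗ b_i` of a decomposition are rank savings.)
2. **Sumset bound** (`tensorRank_indicator₃_le_card_sumset`).  For maps `α β γ` into a finite abelian
   group `H` and `u : H`, the tensor `(a,b,c) ↦ [α a + β b + γ c = u]` has rank at most
   `σ = |{α a + β b}|`, the size of the sumset `α(A) + β(B)` — refining `R ≤ |H|`
   (`tensorRank_indicator₃_le_card`): in the character decomposition
   `[α a + β b + γ c = u] = |H|⁻¹ ∑_ψ ψ(α a) ψ(β b) ψ(γ c − u)` the slices `ψ∘α ⊗ ψ∘β` are functions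
   of `α a + β b`, so they span a space of dimension `≤ σ`.
3. **Consequence** (`tensorRank_kroneckerPow_cwTensor_le_card_sumset_of_realization`).  An abelian
   realization `s a + s b + s c = u ↔ (a,b,c) ∈ supp T_xyz^{⊠N}` gives
   `R(T_{cw,2}^{⊠N}) ≤ |s(A) + s(A)|`, not just `≤ |H|`.  Since `R(T_{cw,2}^{⊠N}) ≤ 4^N` is the
   standing bound and any value `< 4^N` for one `N` would lower the asymptotic rank of `T_{cw,2}`
   below `4` explicitly (`3` gives `ω = 2`, Coppersmith–Winograd 1990 §11), the relevant search is
   for realizations (and, with weights, degenerations) whose *sumset* is smaller than `4^N`, in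
   groups of any size.  (Computations, not formalised: for `N = 3` every realization in every
   abelian group of order `64 ≤ |H| ≤ 100` has `|s(A)+s(A)| ≥ 64`.)

## References
* D. Coppersmith, S. Winograd, *Matrix multiplication via arithmetic progressions*, J. Symb. Comput. 9
  (1990), §11.
* "Asymptotic Rank Speedup Theorems, Revisited", arXiv:2605.21738 (2026), §5 (Props 5.3–5.4), §7
  (Prop 7.1, Cor 7.1: `R̃(T_{cw,2}) < 3.931`).
* H. Cohn, R. Kleinberg, B. Szegedy, C. Umans, FOCS 2005, arXiv:math/0511460, §1.1 (characters
  diagonalise `ℂ[H]`); in-tree `tensorRank_addGroupAlgTensor_le`.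
-/

noncomputable section

open scoped BigOperators

namespace Summit.MatrixMultiplication.MatrixMultiplication.Theorems

set_option linter.dupNamespace false

open Literature.Computability.AlgebraicComplexity

/-! ### 1. The slice-span lemma -/

section SliceSpan

variable {K : Type*} [Field K] {ι κ μ : Type*}

/-- **Slice-span lemma.** `R(∑_s w_s ⊗ u_s ⊗ v_s) ≤ dim span {w_s ⊗ u_s}`: the rank of a sum of
triads is at most the dimension of the span of its first-two-legs slices. [new] -/
theorem tensorRank_sum_triad_le_finrank_span {S : Type*} [Fintype S]
    (w : S → ι → K) (u : S → κ → K) (v : S → μ → K) :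
    tensorRank (∑ s, triad (w s) (u s) (v s)) ≤
      Module.finrank K (Submodule.span K (Set.range fun s : S => fun a b => w s a * u s b)) := by
  classical
  set M : S → ι → κ → K := fun s a b => w s a * u s b with hM
  obtain ⟨B, hBsub, hBspan, hBli⟩ := exists_linearIndependent K (Set.range M)
  have hBfin : B.Finite := (Set.finite_range M).subset hBsub
  letI : Fintype B := hBfin.fintype
  -- `dim span = |B|`
  have hrank : Module.finrank K (Submodule.span K (Set.range M)) = Fintype.card B := by
    have h := finrank_span_eq_card hBli
    rwa [Subtype.range_coe, hBspan] at h
  rw [hrank]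
  -- every slice is a combination of the basis slices
  have hrep : ∀ s, ∃ c : B → K, ∑ x, c x • (x : ι → κ → K) = M s := by
    intro s
    have hs : M s ∈ Submodule.span K (Set.range (Subtype.val : B → ι → κ → K)) := by
      rw [Subtype.range_coe, hBspan]; exact Submodule.subset_span ⟨s, rfl⟩
    exact (Submodule.mem_span_range_iff_exists_fun K).1 hs
  choose coef hcoef using hrep
  -- every basis slice is a slice
  have hpre : ∀ x : B, ∃ s, M s = x := fun x => hBsub x.2
  choose pre hpre using hpre
  refine tensorRank_le_card_of_eq_sum (fun x : B => w (pre x)) (fun x => u (pre x))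
    (fun x c => ∑ s, coef s x * v s c) ?_
  funext a b c
  simp only [Finset.sum_apply, triad_apply]
  have key : ∀ s, w s a * u s b = ∑ x : B, coef s x * (x : ι → κ → K) a b := by
    intro s
    have h := congrFun (congrFun (hcoef s) a) b
    simp only [Finset.sum_apply, Pi.smul_apply, smul_eq_mul] at h
    exact h.symm
  have key' : ∀ x : B, w (pre x) a * u (pre x) b = (x : ι → κ → K) a b := fun x =>
    congrFun (congrFun (hpre x) a) b
  calc ∑ s, w s a * u s b * v s c
      = ∑ s, (∑ x : B, coef s x * (x : ι → κ → K) a b) * v s c := by simp_rw [key]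
    _ = ∑ s, ∑ x : B, coef s x * (x : ι → κ → K) a b * v s c := by simp_rw [Finset.sum_mul]
    _ = ∑ x : B, ∑ s, coef s x * (x : ι → κ → K) a b * v s c := Finset.sum_comm
    _ = ∑ x : B, w (pre x) a * u (pre x) b * ∑ s, coef s x * v s c := by
        refine Finset.sum_congr rfl fun x _ => ?_
        rw [key' x, Finset.mul_sum]
        exact Finset.sum_congr rfl fun s _ => by ring

end SliceSpan

/-! ### 2. The sumset bound for abelian-group indicator tensors -/

section Sumset

variable {ι κ μ : Type*} [Fintype ι] [Fintype κ]
  {H : Type*} [AddCommGroup H] [Fintype H] [DecidableEq H]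

/-- The sumset `α(A) + β(B) ⊆ H` of two index maps. -/
def sumset₂ (α : ι → H) (β : κ → H) : Finset H :=
  Finset.univ.image fun ab : ι × κ => α ab.1 + β ab.2

omit [Fintype H] in
/-- Membership in the sumset. -/
theorem add_mem_sumset₂ (α : ι → H) (β : κ → H) (a : ι) (b : κ) : α a + β b ∈ sumset₂ α β :=
  Finset.mem_image.2 ⟨(a, b), Finset.mem_univ _, rfl⟩

/-- **Sumset bound.** `R([α a + β b + γ c = u]) ≤ |α(A) + β(B)|`: the character slices
`ψ∘α ⊗ ψ∘β = ψ(α a + β b)` are functions of the sum, so they span at most `|α(A)+β(B)|`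
dimensions, and the slice-span lemma applies to the character decomposition. [new] -/
theorem tensorRank_indicator₃_le_card_sumset (α : ι → H) (β : κ → H) (γ : μ → H) (u : H) :
    tensorRank (fun a b c => if α a + β b + γ c = u then (1 : ℂ) else 0) ≤ (sumset₂ α β).card := by
  classical
  -- character decomposition
  have hdec : (fun a b c => if α a + β b + γ c = u then (1 : ℂ) else 0) =
      ∑ ψ : AddChar H ℂ, triad (fun a => ψ (α a)) (fun b => ψ (β b))
        (fun c => ψ (γ c - u) / (Fintype.card H : ℂ)) := by
    funext a b c
    rw [Finset.sum_apply, Finset.sum_apply, Finset.sum_apply]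
    simp only [triad_apply]
    have key : ∀ ψ : AddChar H ℂ,
        ψ (α a) * ψ (β b) * (ψ (γ c - u) / (Fintype.card H : ℂ)) =
          ψ (α a + β b + γ c - u) / (Fintype.card H : ℂ) := by
      intro ψ
      rw [show α a + β b + γ c - u = α a + β b + (γ c - u) by abel, AddChar.map_add_eq_mul,
        AddChar.map_add_eq_mul]
      ring
    simp_rw [key]
    rw [← Finset.sum_div, AddChar.sum_apply_eq_ite]
    by_cases h : α a + β b + γ c = u
    · rw [if_pos h, if_pos (sub_eq_zero.2 h), div_self (Nat.cast_ne_zero.2 Fintype.card_ne_zero)]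
    · rw [if_neg h, if_neg (fun h' => h (sub_eq_zero.1 h')), zero_div]
  rw [hdec]
  refine (tensorRank_sum_triad_le_finrank_span _ _ _).trans ?_
  -- the slices lie in the span of the indicator functions of the fibres of `(a,b) ↦ α a + β b`
  let W := sumset₂ α β
  let e : W → ι → κ → ℂ := fun x a b => if α a + β b = (x : H) then 1 else 0
  have hle : Submodule.span ℂ (Set.range fun ψ : AddChar H ℂ => fun a b => ψ (α a) * ψ (β b)) ≤
      Submodule.span ℂ (Set.range e) := by
    rw [Submodule.span_le]
    rintro _ ⟨ψ, rfl⟩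
    have hx : (fun a b => ψ (α a) * ψ (β b)) = ∑ x : W, (ψ (x : H)) • e x := by
      funext a b
      simp only [Finset.sum_apply, Pi.smul_apply, smul_eq_mul, e]
      rw [← AddChar.map_add_eq_mul]
      simp_rw [mul_ite, mul_one, mul_zero]
      rw [Finset.sum_eq_single (⟨α a + β b, add_mem_sumset₂ α β a b⟩ : W)]
      · rw [if_pos rfl]
      · intro x _ hx
        rw [if_neg]
        intro h'
        exact hx (Subtype.ext h'.symm)
      · intro h'
        exact absurd (Finset.mem_univ _) h'
    change (fun a b => ψ (α a) * ψ (β b)) ∈ _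
    rw [hx]
    exact Submodule.sum_mem _ fun x _ => Submodule.smul_mem _ _ (Submodule.subset_span ⟨x, rfl⟩)
  refine (Submodule.finrank_mono hle).trans ?_
  exact (finrank_range_le_card e).trans (by simp [W])

/-- The sumset bound refines `R ≤ |H|` (`tensorRank_indicator₃_le_card`): `|α(A) + β(B)| ≤ |H|`. -/
theorem card_sumset₂_le_card (α : ι → H) (β : κ → H) : (sumset₂ α β).card ≤ Fintype.card H :=
  Finset.card_le_univ _

end Sumset

/-! ### 3. Consequence for abelian realizations of `T_{cw,2}^{⊠N}` -/

section Realization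

/-- **Sumset rung.** An abelian realization `s a + s b + s c = u ↔ (a,b,c) ∈ supp T_xyz^{⊠N}` in a
finite abelian group gives `R(T_{cw,2}^{⊠N}) ≤ |s(A) + s(A)|` (the sumset of the image of `s` with
itself), refining `R(T_{cw,2}^{⊠N}) ≤ |H|`
(`tensorRank_kroneckerPow_cwTensor_le_card_of_realization`). [new] -/
theorem tensorRank_kroneckerPow_cwTensor_le_card_sumset_of_realization {N : ℕ} {H : Type*}
    [AddCommGroup H] [Fintype H] [DecidableEq H] (s : (Fin N → Fin 3) → H) (u : H)
    (h : ∀ a b c : Fin N → Fin 3, s a + s b + s c = u ↔ ∀ i, a i ≠ b i ∧ b i ≠ c i ∧ a i ≠ c i) :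
    tensorRank (kroneckerPow (cwTensor ℂ 2) N) ≤ (sumset₂ s s).card := by
  refine (tensorRank_kroneckerPow_cwTensor_le_xyz N).trans ?_
  rw [kroneckerPow_xyzTensor_eq_of_realization h]
  exact tensorRank_indicator₃_le_card_sumset s s s u

/-- The same in the tree's inline form of `T_{cw,2}^{⊠N}` (`cwTwoPow_inline_eq`). [new] -/
theorem tensorRank_cwTwoPow_le_card_sumset_of_realization {N : ℕ} {H : Type*} [AddCommGroup H]
    [Fintype H] [DecidableEq H] (s : (Fin N → Fin 3) → H) (u : H)
    (h : ∀ a b c : Fin N → Fin 3, s a + s b + s c = u ↔ ∀ i, a i ≠ b i ∧ b i ≠ c i ∧ a i ≠ c i) :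
    tensorRank (K := ℂ) (fun a b c : Fin N → Fin 3 => ∏ i,
        (if (a i = 0 ∧ b i = c i ∧ b i ≠ 0) ∨ (b i = 0 ∧ a i = c i ∧ a i ≠ 0) ∨
          (c i = 0 ∧ a i = b i ∧ a i ≠ 0) then (1 : ℂ) else 0)) ≤ (sumset₂ s s).card := by
  rw [cwTwoPow_inline_eq]
  exact tensorRank_kroneckerPow_cwTensor_le_card_sumset_of_realization s u h

end Realization

end Summit.MatrixMultiplication.MatrixMultiplication.Theorems
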